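import Summits.BirchSwinnertonDyer.BirchSwinnertonDyer.Theorems.SignedBaseChangeAnticyclotomicEisensteinDivisibilityCoprimeClassNumberGlue
import Summits.BirchSwinnertonDyer.BirchSwinnertonDyer.Theorems.SignedBaseChangeAnticyclotomicEisensteinDivisibilityCoprimeClassNumber
import HarnessLib

/-!
# Crux `AnticyclotomicEisensteinDivisibility` (stmt-BirchSwinnertonDyer-20727, route SignedBaseChange), line `bdpline` v26 — HEADLINE:
# the parent K1″ `TwistPairGreenbergProductDivisibilityCanonical` from the two-variable Euler-system inclusion, the eleven named facts
# `stub_namedFactsSS` and Form T `stub_signedEisensteinSS_coprime`, modulo ONE further refereed named fact (Beckwith–Raum–Richter 2022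
# Thm. 1) — the `p ∣ h_K` cell of the line is OFF the route's critical path

Width seat `bsd-line-sbc-p1-w2` (gen 7), cell `bsd-ssimc`; helper `--supports stmt-BirchSwinnertonDyer-20727`. ONE THEOREM (0 definitions,
0 named facts, 0 `sorry`), the composite of two landed files written in parallel by the line's LEAD (gen 5) and this seat on 2026-08-28:
* `SignedBaseChangeAcDivCoprimeClassNumber.anticyclotomicEisensteinDivisibility_coprime_of_stubs` (LEAD g5, p642307): AED⁺ — the crux text
  with the extra binder `¬ p ∣ NumberField.classNumber K` after `κ₂.IsAnticyclotomic →` — from the two stub statements `stub_namedFactsSS`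
  and `stub_signedEisensteinSS_coprime` of skeleton v26 (sha16 cbc89a6ac92fac24) VERBATIM, the two `p ∣ h_K` stubs (a2)/S1∣ unused;
* `SignedBaseChangeAcDivCoprimeClassNumber.twistPairGreenbergProductDivisibilityCanonical_of_acDivCoprime` (this seat, p642001):
  `BRR2022_thm_1 → (SignedTwoVariableInputs → AED⁺) → TwoVariableEulerSystemDivisibility → TwistPairGreenbergProductDivisibilityCanonical`,
  K1″'s frame field being chosen with `2` split AND `p ∤ h_K` by the tree's even-rung supply
  `BiquadraticEisensteinDescentHeegnerFieldSupplyEvenRung.exists_twoSplit_split_not_dvd_classNumber` (mod Beckwith–Raum–Richter 2022 Thm. 1).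
HEADLINE: `twistPairGreenbergProductDivisibilityCanonical_of_namedFacts_of_signedEisenstein_of_eulerSystem :
BRR2022_thm_1 → ⟨type of stub_namedFactsSS⟩ → ⟨type of stub_signedEisensteinSS_coprime⟩ → TwoVariableEulerSystemDivisibility →
TwistPairGreenbergProductDivisibilityCanonical`. So, for the ROUTE, crux 20727 is needed only at Heegner fields with `p ∤ h_K`; the planner
may restate it with the binder (skeleton 4 → 2 stubs) — this file is the by-name evidence. CONDITIONAL on every displayed hypothesis (eleven
typed named facts incl. one PRE and one flagged; the research statement Form T; the sibling crux ES; BRR 2022); nothing is discharged; no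
summit statement / BSD is proved by this file.

References: [BeckwithRaumRichter2022] Adv. Math. 409 (2022) 108663, Thm. 1; [LongoVigni2019] Thm. 1.4; [CastellaWan2023] Thm. 6.8;
[YanZhu2024MainConjNonCM] Thms. 3.3, 4.2 (2), 4.7; [BurungaleCastellaSkinner2025] Prop. 4.2.2; [Greenberg2016Selmer] Prop. 4.1.1.
-/

-- `Summit.BirchSwinnertonDyer.BirchSwinnertonDyer.…`: summit and sub-problem share a name (D-0017 layout).
set_option linter.dupNamespace false
set_option autoImplicit false

noncomputable section

namespace Summit.BirchSwinnertonDyer.BirchSwinnertonDyer.Theorems.SignedBaseChangeAcDivCoprimeClassNumberHeadline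

open Summit.BirchSwinnertonDyer.BirchSwinnertonDyer.Theses.SignedBaseChange
open Literature.NumberTheory.EllipticCurves
open Summit.BirchSwinnertonDyer.BirchSwinnertonDyer.Theorems

/-- **K1″ ⇐ BRR 2022 Thm. 1 ∧ `stub_namedFactsSS` ∧ Form T ∧ ES.** The parent `TwistPairGreenbergProductDivisibilityCanonical` of crux
stmt-BirchSwinnertonDyer-20727 from: the refereed class-number fact `BRR2022_thm_1`; `hF` = the type of the registered stub
`stub_namedFactsSS` (eleven typed named facts) VERBATIM; `hT` = the type of the registered research stub `stub_signedEisensteinSS_coprime`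
(Form T) VERBATIM; and the sibling crux `TwoVariableEulerSystemDivisibility` (stmt-BirchSwinnertonDyer-20728) BY NAME — the composite of
p642307 (AED⁺ from the two stubs) and p642001 (K1″ from ES and AED⁺ at a frame field with `p ∤ h_K`). The `p ∣ h_K` stubs of line
`bdpline` do not occur. CONDITIONAL; nothing about BSD is proved. [cite: BeckwithRaumRichter2022, Thm. 1] [cite: LongoVigni2019, Thm. 1.4]
[cite: CastellaWan2023, Thm. 6.8] [cite: YanZhu2024MainConjNonCM, Thms. 3.3, 4.2 (2), 4.7] [cite: BurungaleCastellaSkinner2025, Prop. 4.2.2]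
[claim: BurungaleSkinnerTianWan2024, status: under-review] -/
theorem twistPairGreenbergProductDivisibilityCanonical_of_namedFacts_of_signedEisenstein_of_eulerSystem
    (h22 : Literature.NumberTheory.QuadraticFields.BRR2022_thm_1)
    (hF : (Literature.NumberTheory.EllipticCurves.YanZhu2026.thm42_XGr₂_isTorsion_charIdeal_le_greenbergAnyRoot ∧
      Literature.NumberTheory.EllipticCurves.YanZhu2026.thm47_ord_localised_iff_greenbergAnyRoot_localised_guarded ∧
      Literature.NumberTheory.EllipticCurves.YanZhu2026.thm33_exists_isHidaRankinLFunction) ∧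
    (∀ (W : WeierstrassCurve ℚ) [W.IsGloballyMinimal] (K : Type) [Field K] [NumberField K] (p : ℕ) [Fact p.Prime]
      (κ : Literature.NumberTheory.EllipticCurves.ZpExtension K p) (𝔭 𝔭' : IsDedekindDomain.HeightOneSpectrum (NumberField.RingOfIntegers K)),
      Literature.NumberTheory.EllipticCurves.AcSigned.longoVigni2019_thm14_signedSelmerDual_rank_one W K p κ 𝔭 𝔭') ∧
    (∀ (N : ℕ) [NeZero N] (W : WeierstrassCurve ℚ) [W.IsGloballyMinimal] (K : Type) [Field K] [NumberField K] (p : ℕ) [Fact p.Prime]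
      (κ : Literature.NumberTheory.EllipticCurves.ZpExtension K p) (𝔭 𝔭' : IsDedekindDomain.HeightOneSpectrum (NumberField.RingOfIntegers K)),
      Literature.NumberTheory.EllipticCurves.AcSigned.castellaWan2024_proofThm68_transferInputs N W K p κ 𝔭 𝔭') ∧
    (∀ (N : ℕ) [NeZero N] (W : WeierstrassCurve ℚ) [W.IsGloballyMinimal] (K : Type) [Field K] [NumberField K] (p : ℕ) [Fact p.Prime]
      (κ : Literature.NumberTheory.EllipticCurves.ZpExtension K p) (𝔭 𝔭' : IsDedekindDomain.HeightOneSpectrum (NumberField.RingOfIntegers K)),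
      Literature.NumberTheory.EllipticCurves.AcSigned.castellaWan2024_lemma67_finrank_torsionCharIdeal N W K p κ 𝔭 𝔭') ∧
    (∀ (N : ℕ) [NeZero N] (W : WeierstrassCurve ℚ) [W.IsGloballyMinimal] (K : Type) [Field K] [NumberField K] (p : ℕ) [Fact p.Prime]
      (κ : Literature.NumberTheory.EllipticCurves.ZpExtension K p) (𝔭 𝔭' : IsDedekindDomain.HeightOneSpectrum (NumberField.RingOfIntegers K)),
      Literature.NumberTheory.EllipticCurves.AcSigned.castellaWan2024_proofThm68_selmerRel_le_selmerSgn N W K p κ 𝔭 𝔭') ∧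
    Literature.NumberTheory.EllipticCurves.BertoliniLongoVenerucci2026.thmA_castellaWan_thm68_exists_isCWBDPLFunction_charIdeal_map_le_rat ∧
    (Literature.NumberTheory.IwasawaTheory.Greenberg2016.prop411_selmer_isAlmostDivisible ∧
      Literature.NumberTheory.IwasawaTheory.Greenberg2016.prop422_localCohomology_isAlmostDivisible ∧
      Literature.NumberTheory.IwasawaTheory.Greenberg2006.prop41_globalEulerPoincareCorank ∧
      Literature.NumberTheory.IwasawaTheory.Greenberg2006.prop42_localEulerPoincareCorank ∧
      Literature.NumberTheory.IwasawaTheory.Greenberg2006.prop32_cohomology_isCofinitelyGenerated) ∧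
    Literature.NumberTheory.EllipticCurves.BurungaleSkinnerTianWan2024.prop627_span_minus_eq_span_bdp_supersingular_PRE ∧
    Literature.NumberTheory.EllipticCurves.BurungaleCastellaSkinner2025.prop422_exists_isBDPLFunction_mu_eq_zero)
    (hT : SignedTwoVariableInputs → Literature.NumberTheory.EllipticCurves.ModularForms.nonempty_modularParametrizationData → ∀ (W : WeierstrassCurve ℚ) [W.IsElliptic] [W.IsGloballyMinimal] (p : ℕ) [Fact p.Prime], 5 ≤ p → W.HasGoodReductionAtPrime p → W.frobeniusTrace p = 0 → Literature.NumberTheory.EllipticCurves.Rank1Residual.Surj W p → ∀ (K : Type) [Field K] [NumberField K] (ι : PadicAlgCl p ≃+* ℂ) (v vbar : IsDedekindDomain.HeightOneSpectrum (NumberField.RingOfIntegers K)) (κ₁ κ₂ : Literature.NumberTheory.EllipticCurves.ZpExtension K p) (γ₁ γ₂ : Field.absoluteGaloisGroup K) [Fact (Literature.NumberTheory.EllipticCurves.ZpExtension.IsTopGeneratorPair κ₁ κ₂ γ₁ γ₂)] [NeZero (NumberField.discr K).natAbs] (N : ℕ) [NeZero N] (f : CuspForm (CongruenceSubgroup.Gamma0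 N) 2), Literature.NumberTheory.EllipticCurves.ModularForms.IsNewformOf W f → (N : ℤ) = W.conductorNorm ℤ → Literature.NumberTheory.EllipticCurves.IsImaginaryQuadratic K → ¬ p ∣ NumberField.classNumber K → ((Ideal.span {(p : ℤ)}).primesOver (NumberField.RingOfIntegers K)).ncard = 2 → ((p : ℕ) : NumberField.RingOfIntegers K) ∈ v.asIdeal → ((p : ℕ) : NumberField.RingOfIntegers K) ∈ vbar.asIdeal → vbar ≠ v → (∀ (w : NumberField.InfinitePlace K) (k : NumberField.RingOfIntegers K), k ∈ v.asIdeal ↔ ‖ι.symm (w.embedding (k : K))‖ < 1) → IsCoprime (N : ℤ) (NumberField.discr K) → (∀ ℓ : ℕ, ℓ.Prime → ℓ ∣ N → ((Ideal.span {(ℓ : ℤ)}).primesOver (NumberField.RingOfIntegers K)).ncard = 2) → Odd (NumberField.discr K) → NumberField.discr K ≠ -3 → κ₁.IsCyclotomic → κ₂.IsAnticyclotomic → ∀ (h𝔭 : AcSigned.IsNonsplitIn κ₂ v) (γ𝔭 : Field.absoluteGaloisGroup (v.adicCompletion K)) (hγ𝔭 : κ₂ (resGalOfEmb (closureEmb (K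 := K) (v.adicCompletion K)) γ𝔭) = κ₂ γ₂) (hne : v ≠ vbar) (hvp : ((p : ℕ) : NumberField.RingOfIntegers K) ∈ v.asIdeal) (ΩK : ℂ) (Ωp : (unrIntegers p)ˣ) (L : UnrSeries p) (z : AcSigned.selmerLambdaAdic (W.baseChange K) p κ₂ γ₂ (fun _ ↦ .sgn 1)), ΩK ≠ 0 → CastellaWan2024.IsCWBDPLFunction ι v κ₂ γ₂ f (NumberField.discr K) ΩK ((Ωp : unrIntegers p) : PadicComplex p) L → AcSigned.TransferInputs (W.baseChange K) p κ₂ γ₂ (YanZhu2026.isTopGenerator_of_pair (κ₁ := κ₁) (γ₁ := γ₁) : κ₂.IsTopGenerator γ₂) v h𝔭 γ𝔭 hγ𝔭 vbar hne hvp 1 z L → ∃ k : ℕ, Ideal.span {((p : ℕ) : IwasawaAlgebra p) ^ k} * AcSigned.X.torsionCharIdeal (W.baseChange K) p κ₂ ∅ (fun _ ↦ .sgn 1) (YanZhu2026.isTopGenerator_of_pair (κ₁ := κ₁) (γ₁ := γ₁) : κ₂.IsTopGenerator γ₂) ≤ (AcSigned.signedHeegnerCharIdeal (YanZhu2026.isTopGenerator_of_pair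 (κ₁ := κ₁) (γ₁ := γ₁) : κ₂.IsTopGenerator γ₂) 1 z).map (IwasawaAlgebra.invol p) ^ 2)
    (hE : TwoVariableEulerSystemDivisibility) :
    TwistPairGreenbergProductDivisibilityCanonical :=
  SignedBaseChangeAcDivCoprimeClassNumber.twistPairGreenbergProductDivisibilityCanonical_of_acDivCoprime h22
    (SignedBaseChangeAcDivCoprimeClassNumber.anticyclotomicEisensteinDivisibility_coprime_of_stubs hF hT) hE

end Summit.BirchSwinnertonDyer.BirchSwinnertonDyer.Theorems.SignedBaseChangeAcDivCoprimeClassNumberHeadline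

end
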